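import Mathlib
import Summits.MatrixMultiplication.MatrixMultiplication.Theorems.SubgroupIdentityDesigns.Negative.SplitMonomial

/-!
# Split-monomial certificate: the member placements (all `p`)

Route `LevelGradedCohnUmans`, crux `SubgroupIdentityDesigns`, the `(m,k) = (2,1)` cell, `p`-free
case.  `SplitMonomial.no_levelOne_design_of_splitMonomial` excludes the level-`1` identity design
from the signed two-coset certificate on `O₂⁺(𝔽_p) ∪ O₂⁺(𝔽_p)·g₀` (`g₀` diagonal,
`g₀₀₀g₀₁₁ = d ≠ 1`).  Here the hypotheses are discharged from MEMBERSHIP, with `O₂⁺(𝔽_p)` given in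
shape form (`hD`: every diagonal `y` with `y₀₀y₁₁ = 1` lies in `Hᵢ`; `hR`: every anti-diagonal `y`
with `y₀₁y₁₀ = 1` lies in `Hᵢ`):
* `no_levelOne_design_of_splitMonomial_mem₁/₂/₃` — `O₂⁺(𝔽_p) ∪ {g₀} ⊆ Hᵢ` (equivalently `Hᵢ`
  contains a monomial group `K_Δ = {diag(t₁,t₂), [[0,t₂],[t₁,0]] : t₁t₂ ∈ Δ}`, `1 ≠ Δ ≤ 𝔽_p^×`;
  `Δ = 𝔽_p^×` is the full monomial group `N(T)`), with conjugate forms `…_conj₁/₂/₃`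
  (`DesignConj`);
* `no_levelOne_design_of_splitMonomial₂₁/₃₁/₃₂/₁₂/₁₃/₂₃` — CROSS-MEMBER: `O₂⁺(𝔽_p) ≤ Hᵢ` and the
  toral element `g₀ ∈ Hⱼ`, `j ≠ i` (left translates for `j < i`, right translates for `j > i`).
All `p`; no TPP and no volume hypothesis.  At `p = 5` the same-member form settles the `p`-free
member class `Z·2.S₄ ⊇ N(T)` (class 45; profiles `(3,3,96)`, `(3,96,3)`, `(96,3,3)` above the
floor) left open in `WitnessStatus`, and every class containing `K_{±1}` (orders `16, 32, 48, 96`).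
VALUE = THEOREM, NOT summit progress; the crux item stmt-MatrixMultiplication-14079 is untouched
and remains open.
-/

set_option linter.dupNamespace false

noncomputable section

open scoped BigOperators Classical

open Summit.MatrixMultiplication.MatrixMultiplication.Theorems.LieRankDesigns.Negative (GLm Mat)

namespace Summit.MatrixMultiplication.MatrixMultiplication.Theorems.SubgroupIdentityDesigns.Negative

section SplitMonomialPlacements

variable {p : ℕ} [hp : Fact p.Prime]

/-! ### Same-member placements: a member containing `O₂⁺(𝔽_p)` and a toral `g₀`, `det`-twist `≠ 1` -/

/-- **MIDDLE member ⊇ `O₂⁺(𝔽_p) ∪ {g₀}`**, `g₀` diagonal with `g₀₀₀ g₀₁₁ ≠ 1` ⇒ no level-one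
identity design.  All `p`; no TPP. -/
theorem no_levelOne_design_of_splitMonomial_mem₂ {H₁ H₂ H₃ : Subgroup (GLm p 2)}
    (hD : ∀ y : GLm p 2, (y : Mat p 2) 0 1 = 0 → (y : Mat p 2) 1 0 = 0 →
      (y : Mat p 2) 0 0 * (y : Mat p 2) 1 1 = 1 → y ∈ H₂)
    (hR : ∀ y : GLm p 2, (y : Mat p 2) 0 0 = 0 → (y : Mat p 2) 1 1 = 0 →
      (y : Mat p 2) 0 1 * (y : Mat p 2) 1 0 = 1 → y ∈ H₂)
    (g₀ : GLm p 2) (hg₀ : g₀ ∈ H₂) (h01 : (g₀ : Mat p 2) 0 1 = 0) (h10 : (g₀ : Mat p 2) 1 0 = 0)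
    (htwist : (g₀ : Mat p 2) 0 0 * (g₀ : Mat p 2) 1 1 ≠ 1) :
    ¬ ∃ c : Mat p 2 → ℂ, (∀ M, 1 < M.rank → c M = 0) ∧
      (∑ M, c M * ZMod.stdAddChar (Matrix.trace (M * ((1 : GLm p 2) : Mat p 2)))) = 1 ∧
      ∀ a ∈ H₁, ∀ b ∈ H₂, ∀ g ∈ H₃, a * b * g ≠ 1 →
        (∑ M, c M *
          ZMod.stdAddChar (Matrix.trace (M * ((a * b * g : GLm p 2) : Mat p 2)))) = 0 := by
  obtain ⟨h00, h11⟩ := lower_diag_ne_zero g₀ h01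
  have mid : ∀ x : GLm p 2, x ∈ H₂ → ∃ a ∈ H₁, ∃ b ∈ H₂, ∃ g ∈ H₃, a * b * g = x :=
    fun x hx => ⟨1, H₁.one_mem, x, hx, 1, H₃.one_mem, by rw [one_mul, mul_one]⟩
  refine no_levelOne_design_of_splitMonomial (mul_ne_zero h00 h11) htwist
    (fun x x01 x10 hx _ => mid x (hD x x01 x10 hx)) (fun x x00 x11 hx => mid x (hR x x00 x11 hx))
    (fun x x01 x10 hx => ?_) (fun x x00 x11 hx => ?_)
  · obtain ⟨y, hy, rfl⟩ := splitMonomial_left_diag hD g₀ h01 h10 x x01 x10 hx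
    exact mid _ (H₂.mul_mem hg₀ hy)
  · obtain ⟨y, hy, rfl⟩ := splitMonomial_left_antidiag hR g₀ h01 h10 x x00 x11 hx
    exact mid _ (H₂.mul_mem hg₀ hy)

/-- **FIRST member ⊇ `O₂⁺(𝔽_p) ∪ {g₀}`** ⇒ no level-one identity design. -/
theorem no_levelOne_design_of_splitMonomial_mem₁ {H₁ H₂ H₃ : Subgroup (GLm p 2)}
    (hD : ∀ y : GLm p 2, (y : Mat p 2) 0 1 = 0 → (y : Mat p 2) 1 0 = 0 →
      (y : Mat p 2) 0 0 * (y : Mat p 2) 1 1 = 1 → y ∈ H₁)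
    (hR : ∀ y : GLm p 2, (y : Mat p 2) 0 0 = 0 → (y : Mat p 2) 1 1 = 0 →
      (y : Mat p 2) 0 1 * (y : Mat p 2) 1 0 = 1 → y ∈ H₁)
    (g₀ : GLm p 2) (hg₀ : g₀ ∈ H₁) (h01 : (g₀ : Mat p 2) 0 1 = 0) (h10 : (g₀ : Mat p 2) 1 0 = 0)
    (htwist : (g₀ : Mat p 2) 0 0 * (g₀ : Mat p 2) 1 1 ≠ 1) :
    ¬ ∃ c : Mat p 2 → ℂ, (∀ M, 1 < M.rank → c M = 0) ∧
      (∑ M, c M * ZMod.stdAddChar (Matrix.trace (M * ((1 : GLm p 2) : Mat p 2)))) = 1 ∧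
      ∀ a ∈ H₁, ∀ b ∈ H₂, ∀ g ∈ H₃, a * b * g ≠ 1 →
        (∑ M, c M *
          ZMod.stdAddChar (Matrix.trace (M * ((a * b * g : GLm p 2) : Mat p 2)))) = 0 := by
  obtain ⟨h00, h11⟩ := lower_diag_ne_zero g₀ h01
  have fst : ∀ x : GLm p 2, x ∈ H₁ → ∃ a ∈ H₁, ∃ b ∈ H₂, ∃ g ∈ H₃, a * b * g = x :=
    fun x hx => ⟨x, hx, 1, H₂.one_mem, 1, H₃.one_mem, by rw [mul_one, mul_one]⟩
  refine no_levelOne_design_of_splitMonomial (mul_ne_zero h00 h11) htwist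
    (fun x x01 x10 hx _ => fst x (hD x x01 x10 hx)) (fun x x00 x11 hx => fst x (hR x x00 x11 hx))
    (fun x x01 x10 hx => ?_) (fun x x00 x11 hx => ?_)
  · obtain ⟨y, hy, rfl⟩ := splitMonomial_left_diag hD g₀ h01 h10 x x01 x10 hx
    exact fst _ (H₁.mul_mem hg₀ hy)
  · obtain ⟨y, hy, rfl⟩ := splitMonomial_left_antidiag hR g₀ h01 h10 x x00 x11 hx
    exact fst _ (H₁.mul_mem hg₀ hy)

/-- **LAST member ⊇ `O₂⁺(𝔽_p) ∪ {g₀}`** ⇒ no level-one identity design. -/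
theorem no_levelOne_design_of_splitMonomial_mem₃ {H₁ H₂ H₃ : Subgroup (GLm p 2)}
    (hD : ∀ y : GLm p 2, (y : Mat p 2) 0 1 = 0 → (y : Mat p 2) 1 0 = 0 →
      (y : Mat p 2) 0 0 * (y : Mat p 2) 1 1 = 1 → y ∈ H₃)
    (hR : ∀ y : GLm p 2, (y : Mat p 2) 0 0 = 0 → (y : Mat p 2) 1 1 = 0 →
      (y : Mat p 2) 0 1 * (y : Mat p 2) 1 0 = 1 → y ∈ H₃)
    (g₀ : GLm p 2) (hg₀ : g₀ ∈ H₃) (h01 : (g₀ : Mat p 2) 0 1 = 0) (h10 : (g₀ : Mat p 2) 1 0 = 0)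
    (htwist : (g₀ : Mat p 2) 0 0 * (g₀ : Mat p 2) 1 1 ≠ 1) :
    ¬ ∃ c : Mat p 2 → ℂ, (∀ M, 1 < M.rank → c M = 0) ∧
      (∑ M, c M * ZMod.stdAddChar (Matrix.trace (M * ((1 : GLm p 2) : Mat p 2)))) = 1 ∧
      ∀ a ∈ H₁, ∀ b ∈ H₂, ∀ g ∈ H₃, a * b * g ≠ 1 →
        (∑ M, c M *
          ZMod.stdAddChar (Matrix.trace (M * ((a * b * g : GLm p 2) : Mat p 2)))) = 0 := by
  obtain ⟨h00, h11⟩ := lower_diag_ne_zero g₀ h01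
  have lst : ∀ x : GLm p 2, x ∈ H₃ → ∃ a ∈ H₁, ∃ b ∈ H₂, ∃ g ∈ H₃, a * b * g = x :=
    fun x hx => ⟨1, H₁.one_mem, 1, H₂.one_mem, x, hx, by rw [one_mul, one_mul]⟩
  refine no_levelOne_design_of_splitMonomial (mul_ne_zero h00 h11) htwist
    (fun x x01 x10 hx _ => lst x (hD x x01 x10 hx)) (fun x x00 x11 hx => lst x (hR x x00 x11 hx))
    (fun x x01 x10 hx => ?_) (fun x x00 x11 hx => ?_)
  · obtain ⟨y, hy, rfl⟩ := splitMonomial_left_diag hD g₀ h01 h10 x x01 x10 hx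
    exact lst _ (H₃.mul_mem hg₀ hy)
  · obtain ⟨y, hy, rfl⟩ := splitMonomial_left_antidiag hR g₀ h01 h10 x x00 x11 hx
    exact lst _ (H₃.mul_mem hg₀ hy)

/-! ### Cross-member placements: `O₂⁺(𝔽_p) ≤ Hᵢ`, the toral element `g₀ ∈ Hⱼ` (`j ≠ i`) -/

/-- **`O₂⁺ ≤ H₂`, `g₀ ∈ H₁`** ⇒ no level-one identity design.  All `p`; no TPP. -/
theorem no_levelOne_design_of_splitMonomial₂₁ {H₁ H₂ H₃ : Subgroup (GLm p 2)}
    (hD : ∀ y : GLm p 2, (y : Mat p 2) 0 1 = 0 → (y : Mat p 2) 1 0 = 0 →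
      (y : Mat p 2) 0 0 * (y : Mat p 2) 1 1 = 1 → y ∈ H₂)
    (hR : ∀ y : GLm p 2, (y : Mat p 2) 0 0 = 0 → (y : Mat p 2) 1 1 = 0 →
      (y : Mat p 2) 0 1 * (y : Mat p 2) 1 0 = 1 → y ∈ H₂)
    (g₀ : GLm p 2) (hg₀ : g₀ ∈ H₁) (h01 : (g₀ : Mat p 2) 0 1 = 0) (h10 : (g₀ : Mat p 2) 1 0 = 0)
    (htwist : (g₀ : Mat p 2) 0 0 * (g₀ : Mat p 2) 1 1 ≠ 1) :
    ¬ ∃ c : Mat p 2 → ℂ, (∀ M, 1 < M.rank → c M = 0) ∧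
      (∑ M, c M * ZMod.stdAddChar (Matrix.trace (M * ((1 : GLm p 2) : Mat p 2)))) = 1 ∧
      ∀ a ∈ H₁, ∀ b ∈ H₂, ∀ g ∈ H₃, a * b * g ≠ 1 →
        (∑ M, c M *
          ZMod.stdAddChar (Matrix.trace (M * ((a * b * g : GLm p 2) : Mat p 2)))) = 0 := by
  obtain ⟨h00, h11⟩ := lower_diag_ne_zero g₀ h01
  have mid : ∀ x : GLm p 2, x ∈ H₂ → ∃ a ∈ H₁, ∃ b ∈ H₂, ∃ g ∈ H₃, a * b * g = x :=
    fun x hx => ⟨1, H₁.one_mem, x, hx, 1, H₃.one_mem, by rw [one_mul, mul_one]⟩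
  refine no_levelOne_design_of_splitMonomial (mul_ne_zero h00 h11) htwist
    (fun x x01 x10 hx _ => mid x (hD x x01 x10 hx)) (fun x x00 x11 hx => mid x (hR x x00 x11 hx))
    (fun x x01 x10 hx => ?_) (fun x x00 x11 hx => ?_)
  · obtain ⟨y, hy, rfl⟩ := splitMonomial_left_diag hD g₀ h01 h10 x x01 x10 hx
    exact ⟨g₀, hg₀, y, hy, 1, H₃.one_mem, by rw [mul_one]⟩
  · obtain ⟨y, hy, rfl⟩ := splitMonomial_left_antidiag hR g₀ h01 h10 x x00 x11 hx
    exact ⟨g₀, hg₀, y, hy, 1, H₃.one_mem, by rw [mul_one]⟩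

/-- **`O₂⁺ ≤ H₃`, `g₀ ∈ H₁`** ⇒ no level-one identity design. -/
theorem no_levelOne_design_of_splitMonomial₃₁ {H₁ H₂ H₃ : Subgroup (GLm p 2)}
    (hD : ∀ y : GLm p 2, (y : Mat p 2) 0 1 = 0 → (y : Mat p 2) 1 0 = 0 →
      (y : Mat p 2) 0 0 * (y : Mat p 2) 1 1 = 1 → y ∈ H₃)
    (hR : ∀ y : GLm p 2, (y : Mat p 2) 0 0 = 0 → (y : Mat p 2) 1 1 = 0 →
      (y : Mat p 2) 0 1 * (y : Mat p 2) 1 0 = 1 → y ∈ H₃)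
    (g₀ : GLm p 2) (hg₀ : g₀ ∈ H₁) (h01 : (g₀ : Mat p 2) 0 1 = 0) (h10 : (g₀ : Mat p 2) 1 0 = 0)
    (htwist : (g₀ : Mat p 2) 0 0 * (g₀ : Mat p 2) 1 1 ≠ 1) :
    ¬ ∃ c : Mat p 2 → ℂ, (∀ M, 1 < M.rank → c M = 0) ∧
      (∑ M, c M * ZMod.stdAddChar (Matrix.trace (M * ((1 : GLm p 2) : Mat p 2)))) = 1 ∧
      ∀ a ∈ H₁, ∀ b ∈ H₂, ∀ g ∈ H₃, a * b * g ≠ 1 →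
        (∑ M, c M *
          ZMod.stdAddChar (Matrix.trace (M * ((a * b * g : GLm p 2) : Mat p 2)))) = 0 := by
  obtain ⟨h00, h11⟩ := lower_diag_ne_zero g₀ h01
  have lst : ∀ x : GLm p 2, x ∈ H₃ → ∃ a ∈ H₁, ∃ b ∈ H₂, ∃ g ∈ H₃, a * b * g = x :=
    fun x hx => ⟨1, H₁.one_mem, 1, H₂.one_mem, x, hx, by rw [one_mul, one_mul]⟩
  refine no_levelOne_design_of_splitMonomial (mul_ne_zero h00 h11) htwist
    (fun x x01 x10 hx _ => lst x (hD x x01 x10 hx)) (fun x x00 x11 hx => lst x (hR x x00 x11 hx))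
    (fun x x01 x10 hx => ?_) (fun x x00 x11 hx => ?_)
  · obtain ⟨y, hy, rfl⟩ := splitMonomial_left_diag hD g₀ h01 h10 x x01 x10 hx
    exact ⟨g₀, hg₀, 1, H₂.one_mem, y, hy, by rw [mul_one]⟩
  · obtain ⟨y, hy, rfl⟩ := splitMonomial_left_antidiag hR g₀ h01 h10 x x00 x11 hx
    exact ⟨g₀, hg₀, 1, H₂.one_mem, y, hy, by rw [mul_one]⟩

/-- **`O₂⁺ ≤ H₃`, `g₀ ∈ H₂`** ⇒ no level-one identity design. -/
theorem no_levelOne_design_of_splitMonomial₃₂ {H₁ H₂ H₃ : Subgroup (GLm p 2)}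
    (hD : ∀ y : GLm p 2, (y : Mat p 2) 0 1 = 0 → (y : Mat p 2) 1 0 = 0 →
      (y : Mat p 2) 0 0 * (y : Mat p 2) 1 1 = 1 → y ∈ H₃)
    (hR : ∀ y : GLm p 2, (y : Mat p 2) 0 0 = 0 → (y : Mat p 2) 1 1 = 0 →
      (y : Mat p 2) 0 1 * (y : Mat p 2) 1 0 = 1 → y ∈ H₃)
    (g₀ : GLm p 2) (hg₀ : g₀ ∈ H₂) (h01 : (g₀ : Mat p 2) 0 1 = 0) (h10 : (g₀ : Mat p 2) 1 0 = 0)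
    (htwist : (g₀ : Mat p 2) 0 0 * (g₀ : Mat p 2) 1 1 ≠ 1) :
    ¬ ∃ c : Mat p 2 → ℂ, (∀ M, 1 < M.rank → c M = 0) ∧
      (∑ M, c M * ZMod.stdAddChar (Matrix.trace (M * ((1 : GLm p 2) : Mat p 2)))) = 1 ∧
      ∀ a ∈ H₁, ∀ b ∈ H₂, ∀ g ∈ H₃, a * b * g ≠ 1 →
        (∑ M, c M *
          ZMod.stdAddChar (Matrix.trace (M * ((a * b * g : GLm p 2) : Mat p 2)))) = 0 := by
  obtain ⟨h00, h11⟩ := lower_diag_ne_zero g₀ h01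
  have lst : ∀ x : GLm p 2, x ∈ H₃ → ∃ a ∈ H₁, ∃ b ∈ H₂, ∃ g ∈ H₃, a * b * g = x :=
    fun x hx => ⟨1, H₁.one_mem, 1, H₂.one_mem, x, hx, by rw [one_mul, one_mul]⟩
  refine no_levelOne_design_of_splitMonomial (mul_ne_zero h00 h11) htwist
    (fun x x01 x10 hx _ => lst x (hD x x01 x10 hx)) (fun x x00 x11 hx => lst x (hR x x00 x11 hx))
    (fun x x01 x10 hx => ?_) (fun x x00 x11 hx => ?_)
  · obtain ⟨y, hy, rfl⟩ := splitMonomial_left_diag hD g₀ h01 h10 x x01 x10 hx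
    exact ⟨1, H₁.one_mem, g₀, hg₀, y, hy, by rw [one_mul]⟩
  · obtain ⟨y, hy, rfl⟩ := splitMonomial_left_antidiag hR g₀ h01 h10 x x00 x11 hx
    exact ⟨1, H₁.one_mem, g₀, hg₀, y, hy, by rw [one_mul]⟩

/-- **`O₂⁺ ≤ H₁`, `g₀ ∈ H₂`** ⇒ no level-one identity design (right translates). -/
theorem no_levelOne_design_of_splitMonomial₁₂ {H₁ H₂ H₃ : Subgroup (GLm p 2)}
    (hD : ∀ y : GLm p 2, (y : Mat p 2) 0 1 = 0 → (y : Mat p 2) 1 0 = 0 →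
      (y : Mat p 2) 0 0 * (y : Mat p 2) 1 1 = 1 → y ∈ H₁)
    (hR : ∀ y : GLm p 2, (y : Mat p 2) 0 0 = 0 → (y : Mat p 2) 1 1 = 0 →
      (y : Mat p 2) 0 1 * (y : Mat p 2) 1 0 = 1 → y ∈ H₁)
    (g₀ : GLm p 2) (hg₀ : g₀ ∈ H₂) (h01 : (g₀ : Mat p 2) 0 1 = 0) (h10 : (g₀ : Mat p 2) 1 0 = 0)
    (htwist : (g₀ : Mat p 2) 0 0 * (g₀ : Mat p 2) 1 1 ≠ 1) :
    ¬ ∃ c : Mat p 2 → ℂ, (∀ M, 1 < M.rank → c M = 0) ∧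
      (∑ M, c M * ZMod.stdAddChar (Matrix.trace (M * ((1 : GLm p 2) : Mat p 2)))) = 1 ∧
      ∀ a ∈ H₁, ∀ b ∈ H₂, ∀ g ∈ H₃, a * b * g ≠ 1 →
        (∑ M, c M *
          ZMod.stdAddChar (Matrix.trace (M * ((a * b * g : GLm p 2) : Mat p 2)))) = 0 := by
  obtain ⟨h00, h11⟩ := lower_diag_ne_zero g₀ h01
  have fst : ∀ x : GLm p 2, x ∈ H₁ → ∃ a ∈ H₁, ∃ b ∈ H₂, ∃ g ∈ H₃, a * b * g = x :=
    fun x hx => ⟨x, hx, 1, H₂.one_mem, 1, H₃.one_mem, by rw [mul_one, mul_one]⟩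
  refine no_levelOne_design_of_splitMonomial (mul_ne_zero h00 h11) htwist
    (fun x x01 x10 hx _ => fst x (hD x x01 x10 hx)) (fun x x00 x11 hx => fst x (hR x x00 x11 hx))
    (fun x x01 x10 hx => ?_) (fun x x00 x11 hx => ?_)
  · obtain ⟨y, hy, rfl⟩ := splitMonomial_right_diag hD g₀ h01 h10 x x01 x10 hx
    exact ⟨y, hy, g₀, hg₀, 1, H₃.one_mem, by rw [mul_one]⟩
  · obtain ⟨y, hy, rfl⟩ := splitMonomial_right_antidiag hR g₀ h01 h10 x x00 x11 hx
    exact ⟨y, hy, g₀, hg₀, 1, H₃.one_mem, by rw [mul_one]⟩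

/-- **`O₂⁺ ≤ H₁`, `g₀ ∈ H₃`** ⇒ no level-one identity design (right translates). -/
theorem no_levelOne_design_of_splitMonomial₁₃ {H₁ H₂ H₃ : Subgroup (GLm p 2)}
    (hD : ∀ y : GLm p 2, (y : Mat p 2) 0 1 = 0 → (y : Mat p 2) 1 0 = 0 →
      (y : Mat p 2) 0 0 * (y : Mat p 2) 1 1 = 1 → y ∈ H₁)
    (hR : ∀ y : GLm p 2, (y : Mat p 2) 0 0 = 0 → (y : Mat p 2) 1 1 = 0 →
      (y : Mat p 2) 0 1 * (y : Mat p 2) 1 0 = 1 → y ∈ H₁)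
    (g₀ : GLm p 2) (hg₀ : g₀ ∈ H₃) (h01 : (g₀ : Mat p 2) 0 1 = 0) (h10 : (g₀ : Mat p 2) 1 0 = 0)
    (htwist : (g₀ : Mat p 2) 0 0 * (g₀ : Mat p 2) 1 1 ≠ 1) :
    ¬ ∃ c : Mat p 2 → ℂ, (∀ M, 1 < M.rank → c M = 0) ∧
      (∑ M, c M * ZMod.stdAddChar (Matrix.trace (M * ((1 : GLm p 2) : Mat p 2)))) = 1 ∧
      ∀ a ∈ H₁, ∀ b ∈ H₂, ∀ g ∈ H₃, a * b * g ≠ 1 →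
        (∑ M, c M *
          ZMod.stdAddChar (Matrix.trace (M * ((a * b * g : GLm p 2) : Mat p 2)))) = 0 := by
  obtain ⟨h00, h11⟩ := lower_diag_ne_zero g₀ h01
  have fst : ∀ x : GLm p 2, x ∈ H₁ → ∃ a ∈ H₁, ∃ b ∈ H₂, ∃ g ∈ H₃, a * b * g = x :=
    fun x hx => ⟨x, hx, 1, H₂.one_mem, 1, H₃.one_mem, by rw [mul_one, mul_one]⟩
  refine no_levelOne_design_of_splitMonomial (mul_ne_zero h00 h11) htwist
    (fun x x01 x10 hx _ => fst x (hD x x01 x10 hx)) (fun x x00 x11 hx => fst x (hR x x00 x11 hx))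
    (fun x x01 x10 hx => ?_) (fun x x00 x11 hx => ?_)
  · obtain ⟨y, hy, rfl⟩ := splitMonomial_right_diag hD g₀ h01 h10 x x01 x10 hx
    exact ⟨y, hy, 1, H₂.one_mem, g₀, hg₀, by rw [mul_one]⟩
  · obtain ⟨y, hy, rfl⟩ := splitMonomial_right_antidiag hR g₀ h01 h10 x x00 x11 hx
    exact ⟨y, hy, 1, H₂.one_mem, g₀, hg₀, by rw [mul_one]⟩

/-- **`O₂⁺ ≤ H₂`, `g₀ ∈ H₃`** ⇒ no level-one identity design (right translates). -/
theorem no_levelOne_design_of_splitMonomial₂₃ {H₁ H₂ H₃ : Subgroup (GLm p 2)}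
    (hD : ∀ y : GLm p 2, (y : Mat p 2) 0 1 = 0 → (y : Mat p 2) 1 0 = 0 →
      (y : Mat p 2) 0 0 * (y : Mat p 2) 1 1 = 1 → y ∈ H₂)
    (hR : ∀ y : GLm p 2, (y : Mat p 2) 0 0 = 0 → (y : Mat p 2) 1 1 = 0 →
      (y : Mat p 2) 0 1 * (y : Mat p 2) 1 0 = 1 → y ∈ H₂)
    (g₀ : GLm p 2) (hg₀ : g₀ ∈ H₃) (h01 : (g₀ : Mat p 2) 0 1 = 0) (h10 : (g₀ : Mat p 2) 1 0 = 0)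
    (htwist : (g₀ : Mat p 2) 0 0 * (g₀ : Mat p 2) 1 1 ≠ 1) :
    ¬ ∃ c : Mat p 2 → ℂ, (∀ M, 1 < M.rank → c M = 0) ∧
      (∑ M, c M * ZMod.stdAddChar (Matrix.trace (M * ((1 : GLm p 2) : Mat p 2)))) = 1 ∧
      ∀ a ∈ H₁, ∀ b ∈ H₂, ∀ g ∈ H₃, a * b * g ≠ 1 →
        (∑ M, c M *
          ZMod.stdAddChar (Matrix.trace (M * ((a * b * g : GLm p 2) : Mat p 2)))) = 0 := by
  obtain ⟨h00, h11⟩ := lower_diag_ne_zero g₀ h01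
  have mid : ∀ x : GLm p 2, x ∈ H₂ → ∃ a ∈ H₁, ∃ b ∈ H₂, ∃ g ∈ H₃, a * b * g = x :=
    fun x hx => ⟨1, H₁.one_mem, x, hx, 1, H₃.one_mem, by rw [one_mul, mul_one]⟩
  refine no_levelOne_design_of_splitMonomial (mul_ne_zero h00 h11) htwist
    (fun x x01 x10 hx _ => mid x (hD x x01 x10 hx)) (fun x x00 x11 hx => mid x (hR x x00 x11 hx))
    (fun x x01 x10 hx => ?_) (fun x x00 x11 hx => ?_)
  · obtain ⟨y, hy, rfl⟩ := splitMonomial_right_diag hD g₀ h01 h10 x x01 x10 hx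
    exact ⟨1, H₁.one_mem, y, hy, g₀, hg₀, by rw [one_mul]⟩
  · obtain ⟨y, hy, rfl⟩ := splitMonomial_right_antidiag hR g₀ h01 h10 x x00 x11 hx
    exact ⟨1, H₁.one_mem, y, hy, g₀, hg₀, by rw [one_mul]⟩

/-! ### Conjugate forms: a member containing `x · ⟨O₂⁺(𝔽_p), g₀⟩ · x⁻¹` -/

/-- **Conjugate form, MIDDLE member.** -/
theorem no_levelOne_design_of_splitMonomial_conj₂ {H₁ H₂ H₃ : Subgroup (GLm p 2)} (z : GLm p 2)
    (hD : ∀ y : GLm p 2, (y : Mat p 2) 0 1 = 0 → (y : Mat p 2) 1 0 = 0 →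
      (y : Mat p 2) 0 0 * (y : Mat p 2) 1 1 = 1 → z * y * z⁻¹ ∈ H₂)
    (hR : ∀ y : GLm p 2, (y : Mat p 2) 0 0 = 0 → (y : Mat p 2) 1 1 = 0 →
      (y : Mat p 2) 0 1 * (y : Mat p 2) 1 0 = 1 → z * y * z⁻¹ ∈ H₂)
    (g₀ : GLm p 2) (hg₀ : z * g₀ * z⁻¹ ∈ H₂) (h01 : (g₀ : Mat p 2) 0 1 = 0)
    (h10 : (g₀ : Mat p 2) 1 0 = 0) (htwist : (g₀ : Mat p 2) 0 0 * (g₀ : Mat p 2) 1 1 ≠ 1) :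
    ¬ ∃ c : Mat p 2 → ℂ, (∀ M, 1 < M.rank → c M = 0) ∧
      (∑ M, c M * ZMod.stdAddChar (Matrix.trace (M * ((1 : GLm p 2) : Mat p 2)))) = 1 ∧
      ∀ a ∈ H₁, ∀ b ∈ H₂, ∀ g ∈ H₃, a * b * g ≠ 1 →
        (∑ M, c M *
          ZMod.stdAddChar (Matrix.trace (M * ((a * b * g : GLm p 2) : Mat p 2)))) = 0 := by
  intro h
  exact no_levelOne_design_of_splitMonomial_mem₂ (H₁ := H₁.map (MulAut.conj z⁻¹).toMonoidHom)
    (H₂ := H₂.map (MulAut.conj z⁻¹).toMonoidHom) (H₃ := H₃.map (MulAut.conj z⁻¹).toMonoidHom)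
    (fun y y01 y10 hy => mem_map_conj_inv_of_conj_mem H₂ z y (hD y y01 y10 hy))
    (fun y y00 y11 hy => mem_map_conj_inv_of_conj_mem H₂ z y (hR y y00 y11 hy))
    g₀ (mem_map_conj_inv_of_conj_mem H₂ z g₀ hg₀) h01 h10 htwist
    (DesignConj.design_conj H₁ H₂ H₃ z⁻¹ h)

/-- **Conjugate form, FIRST member.** -/
theorem no_levelOne_design_of_splitMonomial_conj₁ {H₁ H₂ H₃ : Subgroup (GLm p 2)} (z : GLm p 2)
    (hD : ∀ y : GLm p 2, (y : Mat p 2) 0 1 = 0 → (y : Mat p 2) 1 0 = 0 →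
      (y : Mat p 2) 0 0 * (y : Mat p 2) 1 1 = 1 → z * y * z⁻¹ ∈ H₁)
    (hR : ∀ y : GLm p 2, (y : Mat p 2) 0 0 = 0 → (y : Mat p 2) 1 1 = 0 →
      (y : Mat p 2) 0 1 * (y : Mat p 2) 1 0 = 1 → z * y * z⁻¹ ∈ H₁)
    (g₀ : GLm p 2) (hg₀ : z * g₀ * z⁻¹ ∈ H₁) (h01 : (g₀ : Mat p 2) 0 1 = 0)
    (h10 : (g₀ : Mat p 2) 1 0 = 0) (htwist : (g₀ : Mat p 2) 0 0 * (g₀ : Mat p 2) 1 1 ≠ 1) :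
    ¬ ∃ c : Mat p 2 → ℂ, (∀ M, 1 < M.rank → c M = 0) ∧
      (∑ M, c M * ZMod.stdAddChar (Matrix.trace (M * ((1 : GLm p 2) : Mat p 2)))) = 1 ∧
      ∀ a ∈ H₁, ∀ b ∈ H₂, ∀ g ∈ H₃, a * b * g ≠ 1 →
        (∑ M, c M *
          ZMod.stdAddChar (Matrix.trace (M * ((a * b * g : GLm p 2) : Mat p 2)))) = 0 := by
  intro h
  exact no_levelOne_design_of_splitMonomial_mem₁ (H₁ := H₁.map (MulAut.conj z⁻¹).toMonoidHom)
    (H₂ := H₂.map (MulAut.conj z⁻¹).toMonoidHom) (H₃ := H₃.map (MulAut.conj z⁻¹).toMonoidHom)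
    (fun y y01 y10 hy => mem_map_conj_inv_of_conj_mem H₁ z y (hD y y01 y10 hy))
    (fun y y00 y11 hy => mem_map_conj_inv_of_conj_mem H₁ z y (hR y y00 y11 hy))
    g₀ (mem_map_conj_inv_of_conj_mem H₁ z g₀ hg₀) h01 h10 htwist
    (DesignConj.design_conj H₁ H₂ H₃ z⁻¹ h)

/-- **Conjugate form, LAST member.** -/
theorem no_levelOne_design_of_splitMonomial_conj₃ {H₁ H₂ H₃ : Subgroup (GLm p 2)} (z : GLm p 2)
    (hD : ∀ y : GLm p 2, (y : Mat p 2) 0 1 = 0 → (y : Mat p 2) 1 0 = 0 →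
      (y : Mat p 2) 0 0 * (y : Mat p 2) 1 1 = 1 → z * y * z⁻¹ ∈ H₃)
    (hR : ∀ y : GLm p 2, (y : Mat p 2) 0 0 = 0 → (y : Mat p 2) 1 1 = 0 →
      (y : Mat p 2) 0 1 * (y : Mat p 2) 1 0 = 1 → z * y * z⁻¹ ∈ H₃)
    (g₀ : GLm p 2) (hg₀ : z * g₀ * z⁻¹ ∈ H₃) (h01 : (g₀ : Mat p 2) 0 1 = 0)
    (h10 : (g₀ : Mat p 2) 1 0 = 0) (htwist : (g₀ : Mat p 2) 0 0 * (g₀ : Mat p 2) 1 1 ≠ 1) :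
    ¬ ∃ c : Mat p 2 → ℂ, (∀ M, 1 < M.rank → c M = 0) ∧
      (∑ M, c M * ZMod.stdAddChar (Matrix.trace (M * ((1 : GLm p 2) : Mat p 2)))) = 1 ∧
      ∀ a ∈ H₁, ∀ b ∈ H₂, ∀ g ∈ H₃, a * b * g ≠ 1 →
        (∑ M, c M *
          ZMod.stdAddChar (Matrix.trace (M * ((a * b * g : GLm p 2) : Mat p 2)))) = 0 := by
  intro h
  exact no_levelOne_design_of_splitMonomial_mem₃ (H₁ := H₁.map (MulAut.conj z⁻¹).toMonoidHom)
    (H₂ := H₂.map (MulAut.conj z⁻¹).toMonoidHom) (H₃ := H₃.map (MulAut.conj z⁻¹).toMonoidHom)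
    (fun y y01 y10 hy => mem_map_conj_inv_of_conj_mem H₃ z y (hD y y01 y10 hy))
    (fun y y00 y11 hy => mem_map_conj_inv_of_conj_mem H₃ z y (hR y y00 y11 hy))
    g₀ (mem_map_conj_inv_of_conj_mem H₃ z g₀ hg₀) h01 h10 htwist
    (DesignConj.design_conj H₁ H₂ H₃ z⁻¹ h)

end SplitMonomialPlacements

end Summit.MatrixMultiplication.MatrixMultiplication.Theorems.SubgroupIdentityDesigns.Negative

end
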